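import Summits.HodgeConjecture.HodgeConjecture.Theorems.EquidimHeckeQuotientMap
import Literature.AlgebraicGeometry.ModuliOfAbelianVarieties.SiegelHeckeLinkMultiplier
import HarnessLib

/-!
# Socket (B) bound against ★ `HeckeLinked`: the isogeny-quotient map at a Hecke-linked point, from a quotient family
# (the `SocketQuotientMap` wrapper of the Hecke-link line; sockets do not move — B-plan1 (g14) 21:19:02Z)

Cell hodgecm-mathlib (D-0151), crux `hDel` / E-road line `EquidimOfF`, Hecke-link sub-line, socket (B) (B-p14 (g14)).  THEOREMS ONLY;
no definition, no named fact, no instance, no `sorry`.  HC_CM is proved only modulo the printed citations until rung 0 closes.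

★ `exists_periodCompatibleMap_of_quotientFamily` (p745772) produces the ∃-body of `SocketQuotientMap` from EXPLICIT link data.  Here
the data are UNPACKED from ★ `HeckeLinked 𝓜 𝓜′ r′ (ι′ s′) x` (p742531) and the integer multiplier is RECOVERED on the (B) side
(★ `QuotientAdapted.exists_nat_multiplier`, B-p13 (g16)), so the statement binds exactly what the socket binds: `HeckeLinked … →`,
one `(Z, r′)`-admissible pair of class `ι′ s′` (from `IsThickAtWith`), and the quotient FAMILY for every admissible link datum
(`hfam`, the H2/H4-ALG export: for all `(γ, r, ν)` with ★ `QuotientAdapted δ δ N N′ r r′ γ`, `r ∈ K_δ(1)`, `ᵗγE_δγ = ν•E_δ`, an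
algebraic `qℂ : S″ ⟶ 𝓜_ℂ` with a pointwise Hecke quotient of class `qℂ(s)` at every complex point, section-kernel shape ★ p745395).

* `exists_periodCompatibleMap_of_heckeLinked` — `HeckeLinked 𝓜 𝓜′ r′ (ι′ s′) x → hex → hfam → ∃ Φ …` (the socket's body).
-/

set_option autoImplicit false

noncomputable section

open CategoryTheory CategoryTheory.Limits AlgebraicGeometry Matrix Topology
open Literature.AlgebraicGeometry.Motives (SchemeOver ComplexPoints AlgPoints specOver AbelianVariety CartierDivisor)
open Literature.AlgebraicGeometry.AbelianSchemes (PolarizedAbelianSchemeWithLevel AbelianSchemeOver)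
open Literature.NumberTheory.Automorphic (siegelUpperHalfSpace)
open Literature.NumberTheory.Adeles
open Literature.AlgebraicGeometry.ModuliOfAbelianVarieties

namespace Summit.HodgeConjecture.CorCM.HypDel.EquidimHeckeQuotient

open SiegelModuli
open scoped MonObj

/-- **SOCKET (B) AT A HECKE-LINKED POINT, FROM A QUOTIENT FAMILY** (module docstring): `HeckeLinked 𝓜 𝓜′ r′ (ι′ s′) x`, one
`(Z, r′)`-admissible pair of class `ι′ s′`, and the quotient family for every admissible link datum give the ∃-body of
`SocketQuotientMap` (continuous `Φ` with `Φ s′ = x`, open `θ`, principal `r`, period compatibility).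
[cite: Milne2005ShimuraVarieties, §5 p. 58 (Def. 5.14) and §6 Thm. 6.11 p. 74 and p. 75]
[cite: MumfordFogartyKirwan1994, Ch. 7 §3 (p. 139)] -/
theorem exists_periodCompatibleMap_of_heckeLinked {g N N' d : ℕ} {δ : Fin g → ℕ} (hδ : IsPolarizationType δ)
    (hg : 0 < g) (hN : 3 ≤ N) (hd : N' = N * d) (hd0 : d ≠ 0)
    (𝓜 : SiegelFineModuliScheme g N δ) (𝓜' : SiegelFineModuliScheme g N' δ) [IsLocallyNoetherian (specOver ℚ ℂ).left]
    {S'' : SchemeOver ℂ} (ι' : S'' ⟶ (Literature.AlgebraicGeometry.Motives.baseChange ℚ ℂ).obj 𝓜'.M)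
    (s' : ComplexPoints S'') (x : ComplexPoints ((Literature.AlgebraicGeometry.Motives.baseChange ℚ ℂ).obj 𝓜.M))
    (r' : gspFinAdelic δ) (hlink : HeckeLinked 𝓜 𝓜' r' (AlgPoints.map (L := ℂ) ι' s') x)
    (hex : ∃ (Z : siegelUpperHalfSpace g) (P' : PolarizedAbelianSchemeWithLevel g N' δ (specOver ℚ ℂ).left),
      IsAdmissibleAt hδ r' Z.1 Z.2 P' ∧
      AlgPoints.baseChangeEquiv (algebraMap ℚ ℂ) 𝓜'.M (𝓜'.classifyingMap (specOver ℚ ℂ) P') = AlgPoints.map (L := ℂ) ι' s')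
    (hfam : ∀ (γq : GL (Fin g ⊕ Fin g) ℚ) (r : gspFinAdelic δ) (_ : r ∈ principalLevelSubgroup δ 1) (ν : ℕ),
      QuotientAdapted δ δ N N' r r' γq →
      (γq : Matrix (Fin g ⊕ Fin g) (Fin g ⊕ Fin g) ℚ)ᵀ * typeFormOver δ ℚ *
        (γq : Matrix (Fin g ⊕ Fin g) (Fin g ⊕ Fin g) ℚ) = (ν : ℚ) • typeFormOver δ ℚ →
      ∃ qℂ : S'' ⟶ (Literature.AlgebraicGeometry.Motives.baseChange ℚ ℂ).obj 𝓜.M, ∀ s : ComplexPoints S'',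
      ∃ (U : PolarizedAbelianSchemeWithLevel g N' δ (specOver ℚ ℂ).left)
        (_ : AlgPoints.baseChangeEquiv (algebraMap ℚ ℂ) 𝓜'.M (𝓜'.classifyingMap (specOver ℚ ℂ) U) =
          AlgPoints.map (L := ℂ) ι' s)
        (Q : PolarizedAbelianSchemeWithLevel g N δ (specOver ℚ ℂ).left)
        (ψ : (U.A.fibre (𝟙 (Spec (CommRingCat.of ℂ)))).toAbelianVariety ⟶
          (Q.A.fibre (𝟙 (Spec (CommRingCat.of ℂ)))).toAbelianVariety)
        (_ : IsDominant ψ.hom.hom.hom.left),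
        (Q.A.fibre (𝟙 (Spec (CommRingCat.of ℂ)))).toAbelianVariety.dim = g ∧
        (∀ P : (U.A.fibre (𝟙 (Spec (CommRingCat.of ℂ)))).toAbelianVariety.Points ℂ,
          AlgPoints.map ψ.hom.hom.hom P = 1 ↔
            ∃ c : Fin g ⊕ Fin g → ZMod N',
              (∃ v : Fin g ⊕ Fin g → ℚ,
                (γq : Matrix (Fin g ⊕ Fin g) (Fin g ⊕ Fin g) ℚ) *ᵥ v ∈ latticeOfGL (r : GL (Fin g ⊕ Fin g) finAdeleQ) ∧
                AdelicCongr ((r'⁻¹ : gspFinAdelic δ) : GL (Fin g ⊕ Fin g) finAdeleQ) 1 v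
                  (fun i => ((c i).val : ℚ) / N')) ∧
              P = U.A.restrictPt (𝟙 (Spec (CommRingCat.of ℂ))) (U.level.section_ c)) ∧
        Function.Surjective (AlgPoints.map (L := ℂ) ψ.hom.hom.hom :
          (U.A.fibre (𝟙 (Spec (CommRingCat.of ℂ)))).toAbelianVariety.Points ℂ →
            (Q.A.fibre (𝟙 (Spec (CommRingCat.of ℂ)))).toAbelianVariety.Points ℂ) ∧
        (∀ i : Fin g ⊕ Fin g,
          Q.A.restrictPt (𝟙 (Spec (CommRingCat.of ℂ))) (Q.level.σ i) =
            AlgPoints.map ψ.hom.hom.hom (U.A.restrictPt (𝟙 (Spec (CommRingCat.of ℂ))) (U.level.σ i ^ d))) ∧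
        (∀ (Θ' : CartierDivisor (U.A.fibre (𝟙 (Spec (CommRingCat.of ℂ)))).toAbelianVariety.X.left)
          (Θ : CartierDivisor (Q.A.fibre (𝟙 (Spec (CommRingCat.of ℂ)))).toAbelianVariety.X.left),
          U.A.IsLambdaOfAt (𝟙 (Spec (CommRingCat.of ℂ))) U.D U.pol.lam Θ' →
          Q.A.IsLambdaOfAt (𝟙 (Spec (CommRingCat.of ℂ))) Q.D Q.pol.lam Θ →
          ∀ y : (U.A.fibre (𝟙 (Spec (CommRingCat.of ℂ)))).toAbelianVariety.Points ℂ,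
            (((Θ.pullback ψ.hom.hom.hom.left + -(ν • Θ')).pullback
              ((U.A.fibre (𝟙 (Spec (CommRingCat.of ℂ)))).toAbelianVariety.translation y).left).LinEquiv
              (Θ.pullback ψ.hom.hom.hom.left + -(ν • Θ')))) ∧
        AlgPoints.baseChangeEquiv (algebraMap ℚ ℂ) 𝓜.M (𝓜.classifyingMap (specOver ℚ ℂ) Q) = AlgPoints.map (L := ℂ) qℂ s) :
    ∃ (Φ : ComplexPoints S'' → ComplexPoints ((Literature.AlgebraicGeometry.Motives.baseChange ℚ ℂ).obj 𝓜.M))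
      (_ : Continuous Φ) (_ : Φ s' = x)
      (θ : siegelUpperHalfSpace g → siegelUpperHalfSpace g) (_ : IsOpenMap θ)
      (r : gspFinAdelic δ) (_ : r ∈ principalLevelSubgroup δ 1),
      ∀ (s : ComplexPoints S'') (Z : siegelUpperHalfSpace g)
        (P' : PolarizedAbelianSchemeWithLevel g N' δ (specOver ℚ ℂ).left),
        IsAdmissibleAt hδ r' Z.1 Z.2 P' →
        AlgPoints.baseChangeEquiv (algebraMap ℚ ℂ) 𝓜'.M (𝓜'.classifyingMap (specOver ℚ ℂ) P') = AlgPoints.map (L := ℂ) ι' s →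
        ∃ P : PolarizedAbelianSchemeWithLevel g N δ (specOver ℚ ℂ).left,
          IsAdmissibleAt hδ r (θ Z).1 (θ Z).2 P ∧
          AlgPoints.baseChangeEquiv (algebraMap ℚ ℂ) 𝓜.M (𝓜.classifyingMap (specOver ℚ ℂ) P) = Φ s := by
  -- unpack the link
  obtain ⟨hδ₀, hδ'₀, θ, hθo, γq, hθ, r, hr, -, hQA, hcut⟩ := hlink
  -- the integer multiplier, recovered on the (B) side
  obtain ⟨ν, -, hQA3⟩ := QuotientAdapted.exists_nat_multiplier hδ hg hQA hr
  obtain ⟨qℂ, hq⟩ := hfam γq r hr ν hQA hQA3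
  exact exists_periodCompatibleMap_of_quotientFamily hδ hg hN hd hd0 𝓜 𝓜' ι' s' x r r' hr γq ν θ hθo hθ hQA hQA3
    (fun Z P' hP' hcls => hcut Z P' hP' hcls) hex ⟨qℂ, hq⟩

end Summit.HodgeConjecture.CorCM.HypDel.EquidimHeckeQuotient

end
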